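import Summits.BirchSwinnertonDyer.BirchSwinnertonDyer.Theorems.ManinLocalTwoThreeNotTrivialEisensteinModThreeCyclotomicCore
import Literature.NumberTheory.EllipticCurves.DivisionFieldRamificationPrimePowProofs
import Mathlib.NumberTheory.NumberField.Cyclotomic.Ideal
import HarnessLib

/-!
# Two inputs for E-es-69♮ on the reducible locus: inertia at `q` exhausts `Gal(ℚ(μ_{q^{M+1}})/ℚ)`, and the
# trichotomy for a fixed-point-free-free stabiliser image in `GL₂(𝔽₃)`

Summit `BirchSwinnertonDyer`, route `ManinLocalTwoThree` (cell bsd-f2-manin), crux C3 `ManinPrimeToThreeAtNine`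
(stmt-BirchSwinnertonDyer-22968).  Sequel of `…NotTrivialEisensteinModThreeCyclotomicCore` (irreducible locus); the two lemmas
below feed `…NotTrivialEisensteinModThreeMultiplicative` (es's law E-es-69♮ `NotTrivialEisensteinModThreeMultiplicative` at a
prime of multiplicative reduction, ALL `W`):

* §1 **`exists_mem_inertia_smul_eq_of_pow_eq_one`** — total ramification of `ℚ(μ_{q^{M+1}})` at `q`, in Galois-element form:
  for every `σ ∈ Γ_ℚ` and every prime `𝔓 ∣ q` of `\bar ℤ` some `τ` in the inertia group `I_𝔓 ≤ Γ_ℚ` acts on the `q^{M+1}`-th roots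
  of unity as `σ` does.  Proof: in `L = ℚ(ζ) ⊂ ℚ̄` the inertia group of `P = 𝔓 ∩ 𝓞 L` has order `e(P ∣ q)` (tree
  `ramificationIdx_eq_card_inertia_comap`, over `𝓞 ℚ`; `= e` over `ℤ` by `𝓞 ℚ = ℤ`), which is `φ(q^{M+1}) = [L : ℚ]` (Mathlib
  `IsCyclotomicExtension.Rat.ramificationIdx_eq_of_prime_pow`), so it is all of `Gal(L/ℚ)`; lift `σ|_L` inside `I_𝔓`
  (tree `exists_mem_inertia_restrict_eq`).
* §2 **`stabiliser_image_trichotomy`** — abstract form of the case analysis of `exists_smul_ne_of_fixed_of_irreducible`: for a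
  multiplicative map `A : G → GL₂(𝔽₃)` (as matrices) and a conjugation-stable submonoid-like predicate `F` on `G` such that every
  `A σ`, `F σ`, has a fixed vector, EITHER some `A σ₀` (`F σ₀`) is a transvection whose centre line is `A(G)`-stable, OR no `A σ`
  (`F σ`) is a transvection and some `A σ₁ ≠ 1` (`F σ₁`) is a reflection commuting with all of `A(G)`, OR `A σ = 1` whenever `F σ`.
  Plus residue facts (`decide`): a cube root of `1` in `GL₂(𝔽₃)` has a fixed vector and determinant `1`; determinant `−1` with
  eigenvalue `−1` forces eigenvalue `1`; a transvection commuting with a reflection is trivial.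

Axioms standard; no definitions; nothing about BSD, Manin's conjecture, C2/C3 or E-es-69 is proved.  References: L. Washington,
*Introduction to Cyclotomic Fields* (GTM 83), Prop. 2.3, Lemma 1.4, Thm. 2.5; J. Neukirch, *ANT* I §9 (9.6); J.-P. Serre, Invent. Math. 15
(1972) §5.2; HOME/MEMO-es.md §32 (E-es-69♮).
-/

set_option autoImplicit false
set_option linter.dupNamespace false

noncomputable section

open scoped Classical Matrix IntermediateField

open NumberField IsDedekindDomain Field Polynomial
  Literature.NumberTheory.EllipticCurves Literature.NumberTheory.GaloisRepresentations

namespace Summit.BirchSwinnertonDyer.BirchSwinnertonDyer.Theorems.ManinLocalTwoThree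

/-! ### §1  Inertia at `q` exhausts `Gal(ℚ(μ_{q^{M+1}})/ℚ)` -/

/-- **Inertia at `q` surjects onto `Gal(ℚ(μ_{q^{M+1}})/ℚ)`** (total ramification of the cyclotomic field at `q`, in
Galois-element form): for every `σ ∈ Γ_ℚ`, every place `v ∣ q` of `𝓞 ℚ` and every prime `𝔓` of `\bar ℤ` over `v` there is `τ` in
the inertia group `I_𝔓 ≤ Γ_ℚ` with `τζ = σζ` for all `q^{M+1}`-th roots of unity `ζ`.  See the module docstring.
[cite: Washington1997, Prop. 2.3 and Lemma 1.4] [cite: NeukirchANT1999, Ch. I §9 Prop. (9.6)] -/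
theorem exists_mem_inertia_smul_eq_of_pow_eq_one {q : ℕ} (hq : q.Prime) (M : ℕ)
    (v : HeightOneSpectrum (𝓞 ℚ)) (hv : ((q : ℕ) : 𝓞 ℚ) ∈ v.asIdeal)
    {𝔓 : Ideal (absIntegers (𝓞 ℚ) ℚ)} (h𝔓 : 𝔓 ∈ v.primesAbove) (σ : absoluteGaloisGroup ℚ) :
    ∃ τ ∈ 𝔓.inertia (absoluteGaloisGroup ℚ),
      ∀ ζ : AlgebraicClosure ℚ, ζ ^ q ^ (M + 1) = 1 → τ • ζ = σ • ζ := by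
  classical
  haveI : Fact q.Prime := ⟨hq⟩
  haveI hn : NeZero (q ^ (M + 1)) := ⟨pow_ne_zero _ hq.ne_zero⟩
  haveI hIA : Algebra.IsAlgebraic ℚ (AlgebraicClosure ℚ) := AlgebraicClosure.isAlgebraic ℚ
  haveI : Algebra.IsIntegral ℚ (AlgebraicClosure ℚ) := ⟨fun x ↦ (hIA.isAlgebraic x).isIntegral⟩
  obtain ⟨ζ₀, hζ₀⟩ := HasEnoughRootsOfUnity.exists_primitiveRoot (AlgebraicClosure ℚ) (q ^ (M + 1))
  set L : IntermediateField ℚ (AlgebraicClosure ℚ) := ℚ⟮ζ₀⟯ with hLdef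
  haveI hcyc : IsCyclotomicExtension {q ^ (M + 1)} ℚ L :=
    hζ₀.intermediateField_adjoin_isCyclotomicExtension ℚ
  haveI hfd : FiniteDimensional ℚ L := IsCyclotomicExtension.finite {q ^ (M + 1)} ℚ L
  haveI : NumberField L := IsCyclotomicExtension.numberField {q ^ (M + 1)} ℚ L
  haveI hgal : IsGalois ℚ L := IsCyclotomicExtension.isGalois {q ^ (M + 1)} ℚ L
  haveI h𝔓prime : 𝔓.IsPrime := h𝔓.1
  set P : Ideal (𝓞 L) := 𝔓.comap (ringOfIntegersToIntegralClosure (k := ℚ) (Ω := AlgebraicClosure ℚ) L)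
    with hPdef
  haveI hPprime : P.IsPrime := Ideal.comap_isPrime _ 𝔓
  -- `P` lies over `(q) ⊂ ℤ`
  have hq𝔓 : ((q : ℕ) : absIntegers (𝓞 ℚ) ℚ) ∈ 𝔓 := by
    have h := hv
    rw [h𝔓.2.over, Ideal.mem_comap, map_natCast] at h
    exact h
  have hqP : ((q : ℕ) : 𝓞 L) ∈ P := by
    refine Ideal.mem_comap.mpr ?_
    convert hq𝔓 using 2
    exact map_natCast _ _
  haveI hPq : P.LiesOver (Ideal.span {(q : ℤ)}) := by
    rw [Ideal.liesOver_iff]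
    refine Ideal.IsMaximal.eq_of_le (Int.ideal_span_isMaximal_of_prime q)
      (Ideal.comap_isPrime (algebraMap ℤ (𝓞 L)) P).ne_top ?_
    rw [Ideal.span_singleton_le_iff_mem]
    show algebraMap ℤ (𝓞 L) (q : ℤ) ∈ P
    rw [map_natCast]
    exact hqP
  -- `#I_P(Gal(L/ℚ)) = e(P | q) = φ(q^{M+1}) = [L : ℚ] = #Gal(L/ℚ)`
  have hcard : Nat.card ↥(P.inertia (L ≃ₐ[ℚ] L)) = Nat.card (L ≃ₐ[ℚ] L) := by
    have h1 := @ramificationIdx_eq_card_inertia_comap ℚ _ _ L hfd hgal v 𝔓 h𝔓.1 h𝔓.2 P hPprime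
      (@comap_ringOfIntegersToIntegralClosure_liesOver ℚ _ L v 𝔓 h𝔓.2)
    change P.ramificationIdx (𝓞 ℚ) = Nat.card ↥(P.inertia (L ≃ₐ[ℚ] L)) at h1
    rw [← h1]
    -- `e(P | 𝔭_v) = e(P | (q))`: `𝓞 ℚ = ℤ`
    haveI hPover : P.LiesOver v.asIdeal :=
      @comap_ringOfIntegersToIntegralClosure_liesOver ℚ _ L v 𝔓 h𝔓.2
    have hsurj : Function.Surjective (algebraMap ℤ (𝓞 ℚ)) := by
      have he : algebraMap ℤ (𝓞 ℚ) = (Rat.ringOfIntegersEquiv.symm : ℤ →+* 𝓞 ℚ) := RingHom.ext_int _ _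
      rw [he]
      exact Rat.ringOfIntegersEquiv.symm.surjective
    have hunder : Ideal.span {(q : ℤ)} = v.asIdeal.comap (algebraMap ℤ (𝓞 ℚ)) := by
      haveI := v.isPrime
      refine Ideal.IsMaximal.eq_of_le (Int.ideal_span_isMaximal_of_prime q)
        (Ideal.comap_isPrime (algebraMap ℤ (𝓞 ℚ)) v.asIdeal).ne_top ?_
      rw [Ideal.span_singleton_le_iff_mem, Ideal.mem_comap, map_natCast]
      exact hv
    have hveq : v.asIdeal = (Ideal.span {(q : ℤ)}).map (algebraMap ℤ (𝓞 ℚ)) := by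
      rw [hunder, Ideal.map_comap_of_surjective _ hsurj]
    have hbridge : P.ramificationIdx (𝓞 ℚ) = P.ramificationIdx ℤ := by
      rw [Ideal.ramificationIdx_eq v.asIdeal P, Ideal.ramificationIdx_eq (Ideal.span {(q : ℤ)}) P, hveq,
        Ideal.map_map, RingHom.ext_int ((algebraMap (𝓞 ℚ) (Localization.AtPrime P)).comp (algebraMap ℤ (𝓞 ℚ)))
          (algebraMap ℤ (Localization.AtPrime P))]
    rw [hbridge, IsCyclotomicExtension.Rat.ramificationIdx_eq_of_prime_pow q M L P,
      IsGalois.card_aut_eq_finrank ℚ L,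
      IsCyclotomicExtension.finrank L (cyclotomic.irreducible_rat (NeZero.pos (q ^ (M + 1)))),
      Nat.totient_prime_pow_succ hq]
  have htop : P.inertia (L ≃ₐ[ℚ] L) = ⊤ := Subgroup.eq_top_of_card_eq _ hcard
  -- restrict `σ` to `L` and lift it inside `I_𝔓`
  set g : L ≃ₐ[ℚ] L := AlgEquiv.restrictNormal σ L with hgdef
  have hg : g ∈ P.inertia (L ≃ₐ[ℚ] L) := by rw [htop]; exact Subgroup.mem_top g
  obtain ⟨τ, hτ, hτg⟩ := @exists_mem_inertia_restrict_eq ℚ _ _ L hfd hgal 𝔓 h𝔓.1 g hg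
  refine ⟨τ, hτ, fun ζ hζ ↦ ?_⟩
  obtain ⟨i, -, rfl⟩ := hζ₀.eq_pow_of_pow_eq_one hζ
  have hmem : ζ₀ ^ i ∈ L := pow_mem (IntermediateField.mem_adjoin_simple_self ℚ ζ₀) i
  have h1 := hτg ⟨ζ₀ ^ i, hmem⟩
  have h2 := AlgEquiv.restrictNormal_commutes σ L ⟨ζ₀ ^ i, hmem⟩
  change (show AlgebraicClosure ℚ ≃ₐ[ℚ] AlgebraicClosure ℚ from τ) (ζ₀ ^ i) =
    (show AlgebraicClosure ℚ ≃ₐ[ℚ] AlgebraicClosure ℚ from σ) (ζ₀ ^ i)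
  exact h1.trans h2

/-! ### §2  Residue facts and the trichotomy for a stabiliser image without fixed-point-free elements -/

section MatrixFacts

set_option synthInstance.maxHeartbeats 200000
set_option synthInstance.maxSize 2000

/-- A cube root of `1` in `GL₂(𝔽₃)` (`1` or a transvection) has a fixed vector and determinant `1`. [folklore] -/
theorem exists_mulVec_eq_of_cube_eq_one :
    ∀ (A : Matrix (Fin 2) (Fin 2) (ZMod 3)), A * A * A = 1 →
      A.det = 1 ∧ ∃ v : Fin 2 → ZMod 3, v ≠ 0 ∧ A *ᵥ v = v := by
  decide +kernel

/-- Over `𝔽₃`: determinant `−1` and an eigenvector for `−1 = 2` force an eigenvector for `1`. [folklore] -/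
theorem exists_mulVec_eq_of_det_eq_neg_one_of_mulVec_eq_two_smul :
    ∀ (A : Matrix (Fin 2) (Fin 2) (ZMod 3)) (v : Fin 2 → ZMod 3), A.det = -1 → v ≠ 0 → A *ᵥ v = 2 • v →
      ∃ w : Fin 2 → ZMod 3, w ≠ 0 ∧ A *ᵥ w = w := by
  decide +kernel

/-- Over `𝔽₃`: a cube root of `1` commuting with a reflection is `1`. [folklore] -/
theorem eq_one_of_cube_eq_one_of_commute_reflection :
    ∀ (U S : Matrix (Fin 2) (Fin 2) (ZMod 3)), U * U * U = 1 → S * S = 1 → S.det = -1 → U * S = S * U → U = 1 := by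
  decide +kernel

/-- Over `𝔽₃`: if `A³ = 1` and `A v = 2v` then `v = 0`. [folklore] -/
theorem eq_zero_of_cube_eq_one_of_mulVec_eq_two_smul :
    ∀ (A : Matrix (Fin 2) (Fin 2) (ZMod 3)) (v : Fin 2 → ZMod 3), A * A * A = 1 → A *ᵥ v = 2 • v → v = 0 := by
  decide +kernel

end MatrixFacts

section Trichotomy

variable {G : Type*} [Group G]

/-- **Trichotomy for a stabiliser image without fixed-point-free elements.**  Let `A : G → M₂(𝔽₃)` be multiplicative with
`A 1 = 1`, and `F` a predicate on `G` stable under products and conjugation such that `A σ` has a non-zero fixed vector whenever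
`F σ`.  Then EITHER (a) some `A σ₀` with `F σ₀` is a transvection whose centre `v₀` spans an `A(G)`-stable line; OR (b) no `A σ` with
`F σ` is a transvection, and some `A σ₁ ≠ 1` with `F σ₁` is a reflection, with `+1`-eigenvector `v₁`, commuting with every `A g`; OR
(c) `A σ = 1` whenever `F σ`.  (The case analysis of `exists_smul_ne_of_fixed_of_irreducible`, made abstract.)
[cite: Serre1972, §5.2 (iii)–(iv)] -/
theorem stabiliser_image_trichotomy (F : G → Prop)
    (hFmul : ∀ σ τ : G, F σ → F τ → F (σ * τ)) (hFconj : ∀ g σ : G, F σ → F (g * σ * g⁻¹))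
    (A : G → Matrix (Fin 2) (Fin 2) (ZMod 3)) (hAmul : ∀ σ τ : G, A (σ * τ) = A σ * A τ) (hAone : A 1 = 1)
    (hN : ∀ σ : G, F σ → ∃ v : Fin 2 → ZMod 3, v ≠ 0 ∧ A σ *ᵥ v = v) :
    (∃ (σ₀ : G) (v₀ : Fin 2 → ZMod 3), F σ₀ ∧ A σ₀ * A σ₀ * A σ₀ = 1 ∧ A σ₀ ≠ 1 ∧ v₀ ≠ 0 ∧ A σ₀ *ᵥ v₀ = v₀ ∧
        ∀ g : G, A g *ᵥ v₀ = v₀ ∨ A g *ᵥ v₀ = 2 • v₀) ∨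
    ((∀ σ : G, F σ → A σ * A σ * A σ = 1 → A σ = 1) ∧
      ∃ (σ₁ : G) (v₁ : Fin 2 → ZMod 3), F σ₁ ∧ A σ₁ * A σ₁ = 1 ∧ (A σ₁).det = -1 ∧ v₁ ≠ 0 ∧ A σ₁ *ᵥ v₁ = v₁ ∧
        ∀ g : G, A g * A σ₁ = A σ₁ * A g) ∨
    (∀ σ : G, F σ → A σ = 1) := by
  classical
  have hAinv : ∀ σ : G, A σ⁻¹ * A σ = 1 := fun σ ↦ by rw [← hAmul, inv_mul_cancel, hAone]
  have hAinv' : ∀ σ : G, A σ * A σ⁻¹ = 1 := fun σ ↦ by rw [← hAmul, mul_inv_cancel, hAone]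
  have hAdet : ∀ σ : G, (A σ).det ≠ 0 := by
    intro σ h
    have h1 := congrArg Matrix.det (hAinv σ)
    rw [Matrix.det_mul, h, mul_zero, Matrix.det_one] at h1
    exact zero_ne_one h1
  have hAne : ∀ (σ : G) (v : Fin 2 → ZMod 3), v ≠ 0 → A σ *ᵥ v ≠ 0 := by
    intro σ v hv h
    apply hv
    have := congrArg (fun x ↦ A σ⁻¹ *ᵥ x) h
    simpa only [Matrix.mulVec_mulVec, hAinv, Matrix.one_mulVec, Matrix.mulVec_zero] using this
  by_cases hA : ∃ σ₀ : G, F σ₀ ∧ A σ₀ * A σ₀ * A σ₀ = 1 ∧ A σ₀ ≠ 1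
  · -- (a) a transvection `u`: its centre is `A(G)`-stable
    left
    obtain ⟨σ₀, hσ₀, hu3, hu1⟩ := hA
    obtain ⟨v₀, hv₀, huv₀⟩ := hN σ₀ hσ₀
    refine ⟨σ₀, v₀, hσ₀, hu3, hu1, hv₀, huv₀, fun g ↦ ?_⟩
    have hσ' := hFconj g⁻¹ σ₀ hσ₀
    rw [inv_inv] at hσ'
    obtain ⟨w, hw0, hw⟩ := hN _ (hFmul _ _ hσ₀ hσ')
    have hu'3 : A (g⁻¹ * σ₀ * g) * A (g⁻¹ * σ₀ * g) * A (g⁻¹ * σ₀ * g) = 1 := by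
      rw [← hAmul, ← hAmul, show g⁻¹ * σ₀ * g * (g⁻¹ * σ₀ * g) * (g⁻¹ * σ₀ * g) =
        g⁻¹ * (σ₀ * σ₀ * σ₀) * g by group, hAmul, hAmul, hAmul, hAmul, hu3, mul_one, hAinv]
    rw [hAmul, ← Matrix.mulVec_mulVec] at hw
    have hu'w : A (g⁻¹ * σ₀ * g) *ᵥ w = (A σ₀ * A σ₀) *ᵥ w := by
      have := congrArg (fun x ↦ (A σ₀ * A σ₀) *ᵥ x) hw
      simp only [Matrix.mulVec_mulVec] at this
      rw [← mul_assoc, hu3, one_mul] at this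
      exact this
    set z := A (g⁻¹ * σ₀ * g) *ᵥ w - w with hzdef
    have hz1 : A (g⁻¹ * σ₀ * g) *ᵥ z = z := transvection_mulVec_sub_fixed _ w hu'3
    have hu6 : A σ₀ * A σ₀ * (A σ₀ * A σ₀) * (A σ₀ * A σ₀) = 1 := by
      rw [show A σ₀ * A σ₀ * (A σ₀ * A σ₀) * (A σ₀ * A σ₀) = (A σ₀ * A σ₀ * A σ₀) * (A σ₀ * A σ₀ * A σ₀) by
        noncomm_ring, hu3, one_mul]
    have hz2' : (A σ₀ * A σ₀) *ᵥ z = z := by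
      rw [hzdef, hu'w]; exact transvection_mulVec_sub_fixed _ w hu6
    have hz2 : A σ₀ *ᵥ z = z := by
      have := congrArg (fun x ↦ A σ₀ *ᵥ x) hz2'
      simp only [Matrix.mulVec_mulVec] at this
      rw [show A σ₀ * (A σ₀ * A σ₀) = A σ₀ * A σ₀ * A σ₀ from (mul_assoc _ _ _).symm, hu3,
        Matrix.one_mulVec] at this
      exact this.symm
    obtain ⟨x, hx0, hux, hu'x⟩ : ∃ x : Fin 2 → ZMod 3, x ≠ 0 ∧ A σ₀ *ᵥ x = x ∧ A (g⁻¹ * σ₀ * g) *ᵥ x = x := by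
      by_cases hz : z = 0
      · have hu'w' : A (g⁻¹ * σ₀ * g) *ᵥ w = w := sub_eq_zero.mp (by rw [← hzdef, hz])
        refine ⟨w, hw0, ?_, hu'w'⟩
        rw [hu'w', eq_comm] at hu'w
        have := congrArg (fun x ↦ A σ₀ *ᵥ x) hu'w
        simp only [Matrix.mulVec_mulVec] at this
        rwa [show A σ₀ * (A σ₀ * A σ₀) = A σ₀ * A σ₀ * A σ₀ from (mul_assoc _ _ _).symm, hu3,
          Matrix.one_mulVec, eq_comm] at this
      · exact ⟨z, hz, hz2, hz1⟩
    have hu'v₀ : A (g⁻¹ * σ₀ * g) *ᵥ v₀ = v₀ := by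
      rcases transvection_fixed_line (A σ₀) v₀ x hu3 hu1 hv₀ huv₀ hux with h | h | h
      · exact (hx0 h).elim
      · rwa [h] at hu'x
      · rw [h] at hu'x; exact mulVec_eq_of_mulVec_two_smul _ v₀ hu'x
    have hfix : A σ₀ *ᵥ (A g *ᵥ v₀) = A g *ᵥ v₀ := by
      have := congrArg (fun x ↦ A g *ᵥ x) hu'v₀
      simp only [Matrix.mulVec_mulVec] at this
      rwa [hAmul, hAmul, ← mul_assoc, ← mul_assoc, hAinv', one_mul, ← Matrix.mulVec_mulVec] at this
    rcases transvection_fixed_line (A σ₀) v₀ (A g *ᵥ v₀) hu3 hu1 hv₀ huv₀ hfix with h | h | h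
    · exact (hAne g v₀ hv₀ h).elim
    · exact Or.inl h
    · exact Or.inr h
  · push Not at hA
    by_cases hB : ∃ σ₁ : G, F σ₁ ∧ A σ₁ ≠ 1
    · -- (b) no transvection, a reflection `s`: `s` is central
      right; left
      refine ⟨hA, ?_⟩
      obtain ⟨σ₁, hσ₁, hs1⟩ := hB
      obtain ⟨v₁, hv₁, hsv₁⟩ := hN σ₁ hσ₁
      rcases eq_one_or_transvection_or_reflection_of_mulVec_eq (A σ₁) v₁ (hAdet σ₁) hv₁ hsv₁ with
        h1 | ⟨h3, -⟩ | ⟨hs2, hsdet⟩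
      · exact (hs1 h1).elim
      · exact (hs1 (hA σ₁ hσ₁ h3)).elim
      · refine ⟨σ₁, v₁, hσ₁, hs2, hsdet, hv₁, hsv₁, fun g ↦ ?_⟩
        have hσ' := hFconj g σ₁ hσ₁
        obtain ⟨w, hw0, hw⟩ := hN _ (hFmul _ _ hσ₁ hσ')
        have hss' : A σ₁ * A (g * σ₁ * g⁻¹) = 1 := by
          rcases eq_one_or_transvection_or_reflection_of_mulVec_eq (A (σ₁ * (g * σ₁ * g⁻¹))) w (hAdet _) hw0 hw
            with h1 | ⟨h3, -⟩ | ⟨-, hdet'⟩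
          · rwa [hAmul] at h1
          · have := hA _ (hFmul _ _ hσ₁ hσ') h3; rwa [hAmul] at this
          · exfalso
            rw [hAmul, hAmul, hAmul, Matrix.det_mul, Matrix.det_mul, Matrix.det_mul, hsdet,
              mul_comm (A g).det, mul_assoc, ← Matrix.det_mul, hAinv', Matrix.det_one, mul_one] at hdet'
            revert hdet'; decide
        have hs' : A (g * σ₁ * g⁻¹) = A σ₁ := by
          have := congrArg (fun x ↦ A σ₁ * x) hss'
          simp only [← mul_assoc, hs2, one_mul, mul_one] at this
          exact this
        have := congrArg (fun x ↦ x * A g) hs'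
        simp only [hAmul, mul_assoc, hAinv, mul_one] at this
        exact this
    · -- (c)
      right; right
      push Not at hB
      exact hB

end Trichotomy

end Summit.BirchSwinnertonDyer.BirchSwinnertonDyer.Theorems.ManinLocalTwoThree

end
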